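import Summits.Ventures.YMGap.RobustBall.HeatBathSweepSharp
import Summits.Ventures.YMGap.RobustBall.HeatBathMixing
import Summits.Ventures.YMGap.RobustBall.HeatBathConcentration
import Summits.Ventures.YMGap.RobustBall.EnergyVarianceTorusGeometry
import Summits.Ventures.YMGap.RobustBall.HeatBathPoincare
import Summits.Ventures.YMGap.RobustBall.HeatBathPoincareBall
import HarnessLib

/-!
# Robust ball (Y2) — L² RELAXATION OF THE HEAT-BATH ALGORITHM OF STRONG-COUPLING LATTICE YANG–MILLS, UNIFORMLY IN THE VOLUME: cells

HONEST FRAMING: venture file of the cell `pub-ymgap` (QuantumFields programme), track ROBUST-BALL, seat rb-p2 (g13); the lattice Yang–Mills instances of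
the abstract sweep-contraction theorems `HeatBathSweepSharp.variance_sweep_iterate_le_sq` (squared — sharp — rate) and `HeatBathMixing` (warm-start mixing).
LATTICE statements at STRONG COUPLING, Wilson action (class K); nothing about `β → ∞`, the continuum or Clay; no Markov-chain object is constructed — the
statements are inequalities for the iterated heat-bath operator.
★★ `su2_variance_sweep_iterate_le` — `SU(2)`, `d = 4`, HYPOTHESIS-FREE on `0 ≤ β_W < 2/9` (rb-p2 g12's `HeatBathPoincare.su2_heatBathPoincare`, `A = (2 − 9β_W)⁻¹`):
on every torus `(ℤ/L)⁴`, `L ≥ 2`, with `n` links and the random-scan heat-bath operator `P` of the Wilson measure `μ`, for every bounded measurable `f` and every `k`,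
`Var_μ(P^k f) ≤ (1 − (1 − 9β_W/2)/n)^{2k} Var_μ(f)` — the heat-bath algorithm of lattice gauge theory (Creutz 1980) relaxes in `L²(μ)` within `½(1 − 9β_W/2)⁻¹` SWEEPS,
UNIFORMLY IN THE VOLUME, at strong coupling.  ★★ `su2_variance_sweep_iterate_le_onBall` — BALL-UNIFORM: for every member of the torus ball with per-link loads
`(a, ℓ_s, column Λ) ≤ (1/100, 1/500, 1/500)` and every `0 ≤ β_W ≤ 1/8` (`HeatBathPoincareBall.su2_heatBathPoincare_onBall_oneEighth`, `A = 5/4`): the member's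
Gibbs sampler satisfies `Var_{μ_W}(P^k f) ≤ (1 − 2/(5n))^{2k} Var_{μ_W}(f)` — relaxation within `5/4` sweeps, uniformly in the member and the volume.
★★★ `su2_sweep_iterate_l1_le` + ★★ `su2_sweep_iterate_indicator_le` — WARM-START TOTAL-VARIATION MIXING (`HeatBathMixing`): `SU(2)`, `d = 4`, `0 ≤ β_W < 2/9`,
for every bounded measurable `h` with `∫ h dμ = 1`, `∫ |P^k h − 1| dμ ≤ ((1 − (1 − 9β_W/2)/n)^{2k} Var_μ(h))^{1/2} = (1 − (1 − 9β_W/2)/n)^k ‖h − 1‖_{L²(μ)}` and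
`|∫ (P^k 1_S) h dμ − μ(S)| ≤ ½(…)^{1/2}`: the law after `k` random-scan heat-bath updates from the initial law `h·μ` is within `ε` of `μ` in total variation after
`(1 − 9β_W/2)⁻¹ log(‖h − 1‖₂/ε)` sweeps, uniformly in the volume (a warm-start bound: it depends on `‖h − 1‖_{L²(μ)}`; e.g. `O(β_W|Λ| + log(1/ε))` sweeps from the
`β = 0` product-Haar start).
★★★ `su2_measureReal_deviation_ge_le` ∕ `…_le_le` — EXPONENTIAL CONCENTRATION (`HeatBathConcentration`, Gromov–Milman ∕ Aida–Stroock): `SU(2)`, `d = 4`,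
`0 ≤ β_W < 2/9`, every bounded measurable `f` with link oscillations `δ_ℓ`: `μ{±(f − E_μ f) ≥ r} ≤ e^{2/3} exp(−r/√(2(2 − 9β_W)⁻¹ ∑_ℓ δ_ℓ²))`, uniformly in `L`
(plaquette average: deviations `≥ r` have probability `≤ e^{2/3} exp(−r (2 − 9β_W)^{1/2} |Λ_p|^{1/2}/14)`); ★★ `su2_wilsonAction_deviation_ge_le` — the ENERGY cell:
`μ{S_W − E S_W ≥ r} ≤ e^{2/3} exp(−r/√(2(2 − 9β_W)⁻¹ · 576|E|))`, i.e. the action density concentrates at scale `L⁻²` with exponential tails, uniformly in `L`.  uniformly in the volume (a warm-start bound: it depends on `‖h − 1‖_{L²(μ)}`).  0 sorry, 0 definitions.  References: M. Creutz, Phys. Rev. D 21 (1980) 2308;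
L. Wu, Ann. Probab. 34 (2006) 1960; P. Diaconis, L. Saloff-Coste, Ann. Appl. Probab. 6 (1996) 695.  Everything here is proved. [folklore]
-/

noncomputable section

open MeasureTheory Function Real Finset ProbabilityTheory
open Summit.QuantumFields.YangMills.Theorems.StrongPinningPoincare

namespace Summit.Ventures.YMGap.RobustBall.HeatBathSweep

/-! ### The lattice Yang–Mills cell -/

section Wilson

open Literature.MathematicalPhysics.QuantumLattice
open Literature.MathematicalPhysics.QuantumFieldTheory

variable {L : ℕ} [NeZero L]

/-- ★★ **`SU(2)`, `d = 4`, HYPOTHESIS-FREE: THE HEAT-BATH ALGORITHM RELAXES IN `L²` WITHIN `½(1 − 9β_W/2)⁻¹` SWEEPS, UNIFORMLY IN THE VOLUME, on `0 ≤ β_W < 2/9`**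
(tree coupling `β_W/2`): on every torus `(ℤ/L)⁴`, `L ≥ 2`, with `n = |Edge 4 L|` links and the random-scan heat-bath operator `P` of the Wilson measure `μ`,
for every bounded measurable `f` and every `k`, `Var_μ(P^k f) ≤ (1 − (1 − 9β_W/2)/n)^{2k} Var_μ(f)` (the squared — sharp — rate of `HeatBathSweepSharp`). [folklore] -/
theorem su2_variance_sweep_iterate_le {βW : ℝ} (h0 : 0 ≤ βW) (h : βW < 2 / 9) (hL : 1 < L)
    (f : GaugeConfig 4 L (Matrix.specialUnitaryGroup (Fin 2) ℂ) → ℝ) (hf : Measurable f) {M : ℝ} (hM : ∀ U, |f U| ≤ M) (k : ℕ) :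
    variance ((fun g : GaugeConfig 4 L (Matrix.specialUnitaryGroup (Fin 2) ℂ) → ℝ => fun U =>
        (Fintype.card (Edge 4 L) : ℝ)⁻¹ * ∑ ℓ : Edge 4 L, ∫ e, g (update U ℓ e)
          ∂((haarProbability (Matrix.specialUnitaryGroup (Fin 2) ℂ)).tilted
              fun e' => -(βW / 2) * wilsonAction (fundamentalRep (Fin 2)) (update U ℓ e')))^[k] f)
        (wilsonMeasure (d := 4) (L := L) (fundamentalRep (Fin 2)) (βW / 2)) ≤
      ((1 - (1 - 9 * βW / 2) / Fintype.card (Edge 4 L)) ^ 2) ^ k * variance f (wilsonMeasure (d := 4) (L := L) (fundamentalRep (Fin 2)) (βW / 2)) := by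
  classical
  haveI : SecondCountableTopology (Matrix (Fin 2) (Fin 2) ℂ) := inferInstanceAs (SecondCountableTopology (Fin 2 → Fin 2 → ℂ))
  haveI : SecondCountableTopology (Matrix.specialUnitaryGroup (Fin 2) ℂ) := Topology.IsEmbedding.subtypeVal.secondCountableTopology
  have hρc := continuous_fundamentalRep (Fin 2)
  -- the Wilson measure as a tilted product measure
  set V : GaugeConfig 4 L (Matrix.specialUnitaryGroup (Fin 2) ℂ) → ℝ := fun U => -(βW / 2) * wilsonAction (fundamentalRep (Fin 2)) U with hV
  have hVm : Measurable V := (measurable_wilsonAction (fundamentalRep (Fin 2)) hρc).const_mul _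
  obtain ⟨B₁, hB₁⟩ := exists_abs_wilsonAction_le (d := 4) (L := L) (G := Matrix.specialUnitaryGroup (Fin 2) ℂ) (fundamentalRep (Fin 2)) hρc
  have hVb : ∀ U, |V U| ≤ |βW / 2| * B₁ := fun U => by
    simp only [hV, abs_mul, abs_neg]; exact mul_le_mul_of_nonneg_left (hB₁ U) (abs_nonneg _)
  have hμ : wilsonMeasure (d := 4) (L := L) (fundamentalRep (Fin 2)) (βW / 2) =
      (Measure.pi fun _ : Edge 4 L => haarProbability (Matrix.specialUnitaryGroup (Fin 2) ℂ)).tilted V :=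
    wilsonMeasure_eq_tilted_pi (fundamentalRep (Fin 2)) hρc (βW / 2)
  -- the heat-bath Poincaré hypothesis (rb-p2 g12), `A = (2 − 9β_W)⁻¹`
  have hP : ∀ F : GaugeConfig 4 L (Matrix.specialUnitaryGroup (Fin 2) ℂ) → ℝ, Measurable F → (∃ M : ℝ, ∀ x, |F x| ≤ M) →
      variance F ((Measure.pi fun _ : Edge 4 L => haarProbability (Matrix.specialUnitaryGroup (Fin 2) ℂ)).tilted V) ≤
        (2 - 9 * βW)⁻¹ * ∑ i, ∫ x, ∫ e, (F x - F (update x i e)) ^ 2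
          ∂((haarProbability (Matrix.specialUnitaryGroup (Fin 2) ℂ)).tilted fun e => V (update x i e))
          ∂((Measure.pi fun _ : Edge 4 L => haarProbability (Matrix.specialUnitaryGroup (Fin 2) ℂ)).tilted V) := by
    intro F hF hFb
    rw [← hμ]
    exact HeatBathPoincare.su2_heatBathPoincare h0 h hL F hF hFb
  have hA : (0 : ℝ) < (2 - 9 * βW)⁻¹ := inv_pos.2 (by linarith)
  have hn1 : (1 : ℝ) ≤ Fintype.card (Edge 4 L) := by exact_mod_cast Fintype.card_pos
  have hA1 : (2 * (2 - 9 * βW)⁻¹ * Fintype.card (Edge 4 L))⁻¹ ≤ 1 := by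
    rw [inv_le_one_iff₀]; right
    have : (1 : ℝ) ≤ 2 * (2 - 9 * βW)⁻¹ := by
      rw [← div_eq_mul_inv, le_div_iff₀ (by linarith)]; linarith
    nlinarith
  have key := variance_sweep_iterate_le_sq (haarProbability (Matrix.specialUnitaryGroup (Fin 2) ℂ)) hVm hVb hP hA hA1 hf hM k
  have e : (2 * (2 - 9 * βW)⁻¹ * (Fintype.card (Edge 4 L) : ℝ))⁻¹ = (1 - 9 * βW / 2) / Fintype.card (Edge 4 L) := by
    field_simp
  rw [e, ← hμ] at key
  exact key

end Wilson

section Ball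

open Literature.Probability.LatticeModels Literature.Probability.LatticeModels.DobrushinMetric
open Literature.MathematicalPhysics.QuantumLattice hiding torusNorm
open Literature.MathematicalPhysics.QuantumFieldTheory hiding ZdEdge
open Literature.MathematicalPhysics.QuantumFieldTheory.Balaban1983to89.StrongCouplingTorusWindow

variable {L : ℕ} [NeZero L]

/-- ★★ **BALL-UNIFORM: EVERY MEMBER's GIBBS SAMPLER RELAXES WITHIN `5/4` SWEEPS** (`SU(2)`, `d = 4`, per-link loads `(a, ℓ_s, column Λ) ≤ (1/100, 1/500, 1/500)`,
every `0 ≤ β_W ≤ 1/8`, every torus of side `≥ 2` with `n` links): for the random-scan heat-bath operator `P_W` of the member's measure `μ_W`, every bounded measurable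
`f` and every `k`, `Var_{μ_W}(P_W^k f) ≤ (1 − 2/(5n))^{2k} Var_{μ_W}(f)`. [folklore] -/
theorem su2_variance_sweep_iterate_le_onBall {βW : ℝ} (h0 : 0 ≤ βW) (h8 : βW ≤ 1 / 8) (hL : 1 < L) {W : RobustBall.Perturbation 4 L 2}
    (w : RobustBall.LoadWitness W) (ha : ∀ e, w.oscLoad 0 e ≤ 1 / 100) (hs : ∀ e, w.selfLipLoad 0 e ≤ 1 / 500)
    (hcol : ∀ y, ∑ e ∈ univ.erase y, w.crossLip 0 e y ≤ 1 / 500)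
    (f : GaugeConfig 4 L (RobustBall.SUN 2) → ℝ) (hf : Measurable f) {M : ℝ} (hM : ∀ U, |f U| ≤ M) (k : ℕ) :
    variance ((fun g : GaugeConfig 4 L (RobustBall.SUN 2) → ℝ => fun U =>
        (Fintype.card (Edge 4 L) : ℝ)⁻¹ * ∑ ℓ : Edge 4 L, ∫ e, g (update U ℓ e)
          ∂((haarProbability (RobustBall.SUN 2)).tilted fun e' =>
              torusLogWeight (wilsonPlaqWeight 2 (βW / 2)) (update U ℓ e') - W.total (update U ℓ e')))^[k] f)
        (W.perturbedMeasure (fundamentalRep (Fin 2)) (βW / 2)) ≤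
      ((1 - 2 / (5 * Fintype.card (Edge 4 L))) ^ 2) ^ k * variance f (W.perturbedMeasure (fundamentalRep (Fin 2)) (βW / 2)) := by
  classical
  set V : GaugeConfig 4 L (RobustBall.SUN 2) → ℝ := fun U => torusLogWeight (wilsonPlaqWeight 2 (βW / 2)) U - W.total U with hV
  have hVm : Measurable V := RobustBall.measurable_perturbedTorusEnergy W (βW / 2)
  obtain ⟨B₁, hVb⟩ := RobustBall.exists_abs_perturbedTorusEnergy_le W (βW / 2)
  have hμ : W.perturbedMeasure (fundamentalRep (Fin 2)) (βW / 2) =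
      (Measure.pi fun _ : Edge 4 L => haarProbability (RobustBall.SUN 2)).tilted V := RobustBall.perturbedMeasure_eq_tilted W (βW / 2)
  have hP : ∀ F : GaugeConfig 4 L (RobustBall.SUN 2) → ℝ, Measurable F → (∃ M : ℝ, ∀ x, |F x| ≤ M) →
      variance F ((Measure.pi fun _ : Edge 4 L => haarProbability (RobustBall.SUN 2)).tilted V) ≤
        (5 / 4 : ℝ) * ∑ i, ∫ x, ∫ e, (F x - F (update x i e)) ^ 2
          ∂((haarProbability (RobustBall.SUN 2)).tilted fun e => V (update x i e))
          ∂((Measure.pi fun _ : Edge 4 L => haarProbability (RobustBall.SUN 2)).tilted V) := by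
    intro F hF hFb
    rw [← hμ]
    exact RobustBall.HeatBathPoincareBall.su2_heatBathPoincare_onBall_oneEighth h0 h8 hL w ha hs hcol F hF hFb
  have hn1 : (1 : ℝ) ≤ Fintype.card (Edge 4 L) := by exact_mod_cast Fintype.card_pos
  have hA1 : (2 * (5 / 4 : ℝ) * Fintype.card (Edge 4 L))⁻¹ ≤ 1 := by
    rw [inv_le_one_iff₀]; right; nlinarith
  have key := variance_sweep_iterate_le_sq (haarProbability (RobustBall.SUN 2)) hVm hVb hP (by norm_num) hA1 hf hM k
  have e : (2 * (5 / 4 : ℝ) * (Fintype.card (Edge 4 L) : ℝ))⁻¹ = 2 / (5 * Fintype.card (Edge 4 L)) := by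
    field_simp; ring
  rw [e, ← hμ] at key
  exact key

end Ball

section Mixing

open Literature.MathematicalPhysics.QuantumLattice
open Literature.MathematicalPhysics.QuantumFieldTheory

variable {L : ℕ} [NeZero L]

/-- ★★★ **`SU(2)`, `d = 4`, `0 ≤ β_W < 2/9`: WARM-START TOTAL-VARIATION MIXING OF THE HEAT-BATH ALGORITHM, UNIFORMLY IN THE VOLUME** (tree coupling `β_W/2`,
`n = |Edge 4 L|` links, `P` the random-scan heat-bath operator of the Wilson measure `μ`): for every bounded measurable `h` with `∫ h dμ = 1` (an initial law `h·μ`)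
and every `k`, `∫ |P^k h − 1| dμ ≤ ((1 − (1 − 9β_W/2)/n)^{2k} Var_μ(h))^{1/2} = (1 − (1 − 9β_W/2)/n)^k ‖h − 1‖_{L²(μ)}` — the `k`-step law (density `P^k h`,
`HeatBathSweep.integral_sweep_iterate_mul_comm`) is within `ε` of `μ` in total variation after `(1 − 9β_W/2)⁻¹ log(‖h − 1‖_{L²(μ)}/ε)` SWEEPS, uniformly in `L`. [folklore] -/
theorem su2_sweep_iterate_l1_le {βW : ℝ} (h0 : 0 ≤ βW) (h : βW < 2 / 9) (hL : 1 < L)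
    (hd : GaugeConfig 4 L (Matrix.specialUnitaryGroup (Fin 2) ℂ) → ℝ) (hhd : Measurable hd) {M : ℝ} (hM : ∀ U, |hd U| ≤ M)
    (hmean : ∫ U, hd U ∂(wilsonMeasure (d := 4) (L := L) (fundamentalRep (Fin 2)) (βW / 2)) = 1) (k : ℕ) :
    ∫ U, |((fun g : GaugeConfig 4 L (Matrix.specialUnitaryGroup (Fin 2) ℂ) → ℝ => fun U =>
        (Fintype.card (Edge 4 L) : ℝ)⁻¹ * ∑ ℓ : Edge 4 L, ∫ e, g (update U ℓ e)
          ∂((haarProbability (Matrix.specialUnitaryGroup (Fin 2) ℂ)).tilted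
              fun e' => -(βW / 2) * wilsonAction (fundamentalRep (Fin 2)) (update U ℓ e')))^[k] hd) U - 1|
        ∂(wilsonMeasure (d := 4) (L := L) (fundamentalRep (Fin 2)) (βW / 2)) ≤
      Real.sqrt (((1 - (1 - 9 * βW / 2) / Fintype.card (Edge 4 L)) ^ 2) ^ k *
        variance hd (wilsonMeasure (d := 4) (L := L) (fundamentalRep (Fin 2)) (βW / 2))) := by
  classical
  haveI : SecondCountableTopology (Matrix (Fin 2) (Fin 2) ℂ) := inferInstanceAs (SecondCountableTopology (Fin 2 → Fin 2 → ℂ))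
  haveI : SecondCountableTopology (Matrix.specialUnitaryGroup (Fin 2) ℂ) := Topology.IsEmbedding.subtypeVal.secondCountableTopology
  have hρc := continuous_fundamentalRep (Fin 2)
  set V : GaugeConfig 4 L (Matrix.specialUnitaryGroup (Fin 2) ℂ) → ℝ := fun U => -(βW / 2) * wilsonAction (fundamentalRep (Fin 2)) U with hV
  have hVm : Measurable V := (measurable_wilsonAction (fundamentalRep (Fin 2)) hρc).const_mul _
  obtain ⟨B₁, hB₁⟩ := exists_abs_wilsonAction_le (d := 4) (L := L) (G := Matrix.specialUnitaryGroup (Fin 2) ℂ) (fundamentalRep (Fin 2)) hρc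
  have hVb : ∀ U, |V U| ≤ |βW / 2| * B₁ := fun U => by
    simp only [hV, abs_mul, abs_neg]; exact mul_le_mul_of_nonneg_left (hB₁ U) (abs_nonneg _)
  have hμ : wilsonMeasure (d := 4) (L := L) (fundamentalRep (Fin 2)) (βW / 2) =
      (Measure.pi fun _ : Edge 4 L => haarProbability (Matrix.specialUnitaryGroup (Fin 2) ℂ)).tilted V :=
    wilsonMeasure_eq_tilted_pi (fundamentalRep (Fin 2)) hρc (βW / 2)
  -- one-step contraction `θ = (1 − (1 − 9β_W/2)/n)²` (from `su2_variance_sweep_iterate_le` with `k = 1`)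
  have hθ0 : 0 ≤ (1 - (1 - 9 * βW / 2) / (Fintype.card (Edge 4 L) : ℝ)) ^ 2 := sq_nonneg _
  have hcon : ∀ F : GaugeConfig 4 L (Matrix.specialUnitaryGroup (Fin 2) ℂ) → ℝ, Measurable F → (∃ M : ℝ, ∀ x, |F x| ≤ M) →
      variance (fun x => (Fintype.card (Edge 4 L) : ℝ)⁻¹ * ∑ i, ∫ e, F (update x i e)
          ∂((haarProbability (Matrix.specialUnitaryGroup (Fin 2) ℂ)).tilted fun e => V (update x i e)))
        ((Measure.pi fun _ : Edge 4 L => haarProbability (Matrix.specialUnitaryGroup (Fin 2) ℂ)).tilted V) ≤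
        (1 - (1 - 9 * βW / 2) / Fintype.card (Edge 4 L)) ^ 2 *
          variance F ((Measure.pi fun _ : Edge 4 L => haarProbability (Matrix.specialUnitaryGroup (Fin 2) ℂ)).tilted V) := by
    intro F hF hFb
    obtain ⟨MF, hMF⟩ := hFb
    have h1 := su2_variance_sweep_iterate_le (L := L) h0 h hL F hF hMF 1
    rw [Function.iterate_one, pow_one, hμ] at h1
    exact h1
  have key := integral_abs_sweep_iterate_sub_one_le (haarProbability (Matrix.specialUnitaryGroup (Fin 2) ℂ)) hVm hVb hθ0 hcon k hhd hM
    (by rw [← hμ]; exact hmean)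
  rw [← hμ] at key
  exact key

/-- ★★ **EVENTS, `SU(2)`, `d = 4`, `0 ≤ β_W < 2/9`**: for every measurable set `S` of configurations, every bounded measurable `h` with `∫ h dμ = 1` and every `k`,
`|∫ (P^k 1_S) h dμ − μ(S)| ≤ ½ ((1 − (1 − 9β_W/2)/n)^{2k} Var_μ(h))^{1/2}`: the probability of `S` after `k` random-scan heat-bath updates from the law `h·μ`
converges to `μ(S)` geometrically, uniformly in the volume. [folklore] -/
theorem su2_sweep_iterate_indicator_le {βW : ℝ} (h0 : 0 ≤ βW) (h : βW < 2 / 9) (hL : 1 < L)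
    {S : Set (GaugeConfig 4 L (Matrix.specialUnitaryGroup (Fin 2) ℂ))} (hS : MeasurableSet S)
    (hd : GaugeConfig 4 L (Matrix.specialUnitaryGroup (Fin 2) ℂ) → ℝ) (hhd : Measurable hd) {M : ℝ} (hM : ∀ U, |hd U| ≤ M)
    (hmean : ∫ U, hd U ∂(wilsonMeasure (d := 4) (L := L) (fundamentalRep (Fin 2)) (βW / 2)) = 1) (k : ℕ) :
    |∫ U, ((fun g : GaugeConfig 4 L (Matrix.specialUnitaryGroup (Fin 2) ℂ) → ℝ => fun U =>
        (Fintype.card (Edge 4 L) : ℝ)⁻¹ * ∑ ℓ : Edge 4 L, ∫ e, g (update U ℓ e)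
          ∂((haarProbability (Matrix.specialUnitaryGroup (Fin 2) ℂ)).tilted
              fun e' => -(βW / 2) * wilsonAction (fundamentalRep (Fin 2)) (update U ℓ e')))^[k] (S.indicator 1)) U * hd U
        ∂(wilsonMeasure (d := 4) (L := L) (fundamentalRep (Fin 2)) (βW / 2)) -
        (wilsonMeasure (d := 4) (L := L) (fundamentalRep (Fin 2)) (βW / 2)).real S| ≤
      Real.sqrt (((1 - (1 - 9 * βW / 2) / Fintype.card (Edge 4 L)) ^ 2) ^ k *
        variance hd (wilsonMeasure (d := 4) (L := L) (fundamentalRep (Fin 2)) (βW / 2))) / 2 := by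
  classical
  haveI : SecondCountableTopology (Matrix (Fin 2) (Fin 2) ℂ) := inferInstanceAs (SecondCountableTopology (Fin 2 → Fin 2 → ℂ))
  haveI : SecondCountableTopology (Matrix.specialUnitaryGroup (Fin 2) ℂ) := Topology.IsEmbedding.subtypeVal.secondCountableTopology
  have hρc := continuous_fundamentalRep (Fin 2)
  set V : GaugeConfig 4 L (Matrix.specialUnitaryGroup (Fin 2) ℂ) → ℝ := fun U => -(βW / 2) * wilsonAction (fundamentalRep (Fin 2)) U with hV
  have hVm : Measurable V := (measurable_wilsonAction (fundamentalRep (Fin 2)) hρc).const_mul _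
  obtain ⟨B₁, hB₁⟩ := exists_abs_wilsonAction_le (d := 4) (L := L) (G := Matrix.specialUnitaryGroup (Fin 2) ℂ) (fundamentalRep (Fin 2)) hρc
  have hVb : ∀ U, |V U| ≤ |βW / 2| * B₁ := fun U => by
    simp only [hV, abs_mul, abs_neg]; exact mul_le_mul_of_nonneg_left (hB₁ U) (abs_nonneg _)
  have hμ : wilsonMeasure (d := 4) (L := L) (fundamentalRep (Fin 2)) (βW / 2) =
      (Measure.pi fun _ : Edge 4 L => haarProbability (Matrix.specialUnitaryGroup (Fin 2) ℂ)).tilted V :=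
    wilsonMeasure_eq_tilted_pi (fundamentalRep (Fin 2)) hρc (βW / 2)
  have hθ0 : 0 ≤ (1 - (1 - 9 * βW / 2) / (Fintype.card (Edge 4 L) : ℝ)) ^ 2 := sq_nonneg _
  have hcon : ∀ F : GaugeConfig 4 L (Matrix.specialUnitaryGroup (Fin 2) ℂ) → ℝ, Measurable F → (∃ M : ℝ, ∀ x, |F x| ≤ M) →
      variance (fun x => (Fintype.card (Edge 4 L) : ℝ)⁻¹ * ∑ i, ∫ e, F (update x i e)
          ∂((haarProbability (Matrix.specialUnitaryGroup (Fin 2) ℂ)).tilted fun e => V (update x i e)))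
        ((Measure.pi fun _ : Edge 4 L => haarProbability (Matrix.specialUnitaryGroup (Fin 2) ℂ)).tilted V) ≤
        (1 - (1 - 9 * βW / 2) / Fintype.card (Edge 4 L)) ^ 2 *
          variance F ((Measure.pi fun _ : Edge 4 L => haarProbability (Matrix.specialUnitaryGroup (Fin 2) ℂ)).tilted V) := by
    intro F hF hFb
    obtain ⟨MF, hMF⟩ := hFb
    have h1 := su2_variance_sweep_iterate_le (L := L) h0 h hL F hF hMF 1
    rw [Function.iterate_one, pow_one, hμ] at h1
    exact h1
  have key := abs_integral_sweep_iterate_indicator_mul_sub_le (haarProbability (Matrix.specialUnitaryGroup (Fin 2) ℂ)) hVm hVb hθ0 hcon k hS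
    hhd hM (by rw [← hμ]; exact hmean)
  rw [← hμ] at key
  exact key

end Mixing

section Concentration

open Literature.MathematicalPhysics.QuantumLattice
open Literature.MathematicalPhysics.QuantumFieldTheory
open Summit.Ventures.YMGap.RobustBall.HeatBathConcentration

variable {L : ℕ} [NeZero L]

/-- ★★★ **`SU(2)`, `d = 4`, `0 ≤ β_W < 2/9`: EXPONENTIAL CONCENTRATION OF EVERY OBSERVABLE WITH SQUARE-SUMMABLE LINK OSCILLATIONS, UNIFORMLY IN THE VOLUME**
(tree coupling `β_W/2`, Wilson measure `μ` on `(ℤ/L)⁴`, `L ≥ 2`): for every bounded measurable `f` with `|f(U) − f(U[ℓ ↦ g])| ≤ δ_ℓ` for all `U`, `ℓ`, `g` and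
`∑_ℓ δ_ℓ² > 0`, and every `r`, `μ{f − E_μ f ≥ r} ≤ e^{2/3} exp(−r / √(2(2 − 9β_W)⁻¹ ∑_ℓ δ_ℓ²))` (Gromov–Milman ∕ Aida–Stroock from the heat-bath Poincaré
inequality `HeatBathPoincare.su2_heatBathPoincare`; e.g. the plaquette average `|Λ_p|⁻¹ ∑_p ½ Re tr U_p` has `δ_ℓ ≤ 12/|Λ_p|`, so its deviations `≥ r` have
probability `≤ e^{2/3} exp(−r (2 − 9β_W)^{1/2} |Λ_p|^{1/2} / 14)`, since `∑_ℓ δ_ℓ² ≤ 96/|Λ_p|`): a McDiarmid-type inequality of Poincaré (exponential) strength at strong coupling. [folklore] -/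
theorem su2_measureReal_deviation_ge_le {βW : ℝ} (h0 : 0 ≤ βW) (h : βW < 2 / 9) (hL : 1 < L)
    (f : GaugeConfig 4 L (Matrix.specialUnitaryGroup (Fin 2) ℂ) → ℝ) (hf : Measurable f) {M : ℝ} (hM : ∀ U, |f U| ≤ M)
    (δ : Edge 4 L → ℝ) (hδ : ∀ ℓ U g, |f U - f (update U ℓ g)| ≤ δ ℓ) (hD : 0 < ∑ ℓ, δ ℓ ^ 2) (r : ℝ) :
    (wilsonMeasure (d := 4) (L := L) (fundamentalRep (Fin 2)) (βW / 2)).real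
        {U | r ≤ f U - ∫ U', f U' ∂(wilsonMeasure (d := 4) (L := L) (fundamentalRep (Fin 2)) (βW / 2))} ≤
      Real.exp (2 / 3) * Real.exp (-r / Real.sqrt (2 * (2 - 9 * βW)⁻¹ * ∑ ℓ, δ ℓ ^ 2)) := by
  classical
  haveI : SecondCountableTopology (Matrix (Fin 2) (Fin 2) ℂ) := inferInstanceAs (SecondCountableTopology (Fin 2 → Fin 2 → ℂ))
  haveI : SecondCountableTopology (Matrix.specialUnitaryGroup (Fin 2) ℂ) := Topology.IsEmbedding.subtypeVal.secondCountableTopology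
  have hρc := continuous_fundamentalRep (Fin 2)
  set V : GaugeConfig 4 L (Matrix.specialUnitaryGroup (Fin 2) ℂ) → ℝ := fun U => -(βW / 2) * wilsonAction (fundamentalRep (Fin 2)) U with hV
  have hVm : Measurable V := (measurable_wilsonAction (fundamentalRep (Fin 2)) hρc).const_mul _
  obtain ⟨B₁, hB₁⟩ := exists_abs_wilsonAction_le (d := 4) (L := L) (G := Matrix.specialUnitaryGroup (Fin 2) ℂ) (fundamentalRep (Fin 2)) hρc
  have hVb : ∀ U, |V U| ≤ |βW / 2| * B₁ := fun U => by
    simp only [hV, abs_mul, abs_neg]; exact mul_le_mul_of_nonneg_left (hB₁ U) (abs_nonneg _)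
  have hμ : wilsonMeasure (d := 4) (L := L) (fundamentalRep (Fin 2)) (βW / 2) =
      (Measure.pi fun _ : Edge 4 L => haarProbability (Matrix.specialUnitaryGroup (Fin 2) ℂ)).tilted V :=
    wilsonMeasure_eq_tilted_pi (fundamentalRep (Fin 2)) hρc (βW / 2)
  have hP : ∀ F : GaugeConfig 4 L (Matrix.specialUnitaryGroup (Fin 2) ℂ) → ℝ, Measurable F → (∃ M : ℝ, ∀ x, |F x| ≤ M) →
      variance F ((Measure.pi fun _ : Edge 4 L => haarProbability (Matrix.specialUnitaryGroup (Fin 2) ℂ)).tilted V) ≤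
        (2 - 9 * βW)⁻¹ * ∑ i, ∫ x, ∫ e, (F x - F (update x i e)) ^ 2
          ∂((haarProbability (Matrix.specialUnitaryGroup (Fin 2) ℂ)).tilted fun e => V (update x i e))
          ∂((Measure.pi fun _ : Edge 4 L => haarProbability (Matrix.specialUnitaryGroup (Fin 2) ℂ)).tilted V) := by
    intro F hF hFb
    rw [← hμ]
    exact HeatBathPoincare.su2_heatBathPoincare h0 h hL F hF hFb
  have hA : (0 : ℝ) < (2 - 9 * βW)⁻¹ := inv_pos.2 (by linarith)
  have key := measureReal_deviation_ge_le_of_heatBathPoincare (haarProbability (Matrix.specialUnitaryGroup (Fin 2) ℂ)) hVm hVb hP hA hf hM δ hδ hD r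
  rw [← hμ] at key
  exact key

/-- ★★★ **Lower tail, `SU(2)`, `d = 4`, `0 ≤ β_W < 2/9`**: `μ{f − E_μ f ≤ −r} ≤ e^{2/3} exp(−r / √(2(2 − 9β_W)⁻¹ ∑_ℓ δ_ℓ²))`. [folklore] -/
theorem su2_measureReal_deviation_le_le {βW : ℝ} (h0 : 0 ≤ βW) (h : βW < 2 / 9) (hL : 1 < L)
    (f : GaugeConfig 4 L (Matrix.specialUnitaryGroup (Fin 2) ℂ) → ℝ) (hf : Measurable f) {M : ℝ} (hM : ∀ U, |f U| ≤ M)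
    (δ : Edge 4 L → ℝ) (hδ : ∀ ℓ U g, |f U - f (update U ℓ g)| ≤ δ ℓ) (hD : 0 < ∑ ℓ, δ ℓ ^ 2) (r : ℝ) :
    (wilsonMeasure (d := 4) (L := L) (fundamentalRep (Fin 2)) (βW / 2)).real
        {U | f U - ∫ U', f U' ∂(wilsonMeasure (d := 4) (L := L) (fundamentalRep (Fin 2)) (βW / 2)) ≤ -r} ≤
      Real.exp (2 / 3) * Real.exp (-r / Real.sqrt (2 * (2 - 9 * βW)⁻¹ * ∑ ℓ, δ ℓ ^ 2)) := by
  classical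
  haveI : SecondCountableTopology (Matrix (Fin 2) (Fin 2) ℂ) := inferInstanceAs (SecondCountableTopology (Fin 2 → Fin 2 → ℂ))
  haveI : SecondCountableTopology (Matrix.specialUnitaryGroup (Fin 2) ℂ) := Topology.IsEmbedding.subtypeVal.secondCountableTopology
  have hρc := continuous_fundamentalRep (Fin 2)
  set V : GaugeConfig 4 L (Matrix.specialUnitaryGroup (Fin 2) ℂ) → ℝ := fun U => -(βW / 2) * wilsonAction (fundamentalRep (Fin 2)) U with hV
  have hVm : Measurable V := (measurable_wilsonAction (fundamentalRep (Fin 2)) hρc).const_mul _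
  obtain ⟨B₁, hB₁⟩ := exists_abs_wilsonAction_le (d := 4) (L := L) (G := Matrix.specialUnitaryGroup (Fin 2) ℂ) (fundamentalRep (Fin 2)) hρc
  have hVb : ∀ U, |V U| ≤ |βW / 2| * B₁ := fun U => by
    simp only [hV, abs_mul, abs_neg]; exact mul_le_mul_of_nonneg_left (hB₁ U) (abs_nonneg _)
  have hμ : wilsonMeasure (d := 4) (L := L) (fundamentalRep (Fin 2)) (βW / 2) =
      (Measure.pi fun _ : Edge 4 L => haarProbability (Matrix.specialUnitaryGroup (Fin 2) ℂ)).tilted V :=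
    wilsonMeasure_eq_tilted_pi (fundamentalRep (Fin 2)) hρc (βW / 2)
  have hP : ∀ F : GaugeConfig 4 L (Matrix.specialUnitaryGroup (Fin 2) ℂ) → ℝ, Measurable F → (∃ M : ℝ, ∀ x, |F x| ≤ M) →
      variance F ((Measure.pi fun _ : Edge 4 L => haarProbability (Matrix.specialUnitaryGroup (Fin 2) ℂ)).tilted V) ≤
        (2 - 9 * βW)⁻¹ * ∑ i, ∫ x, ∫ e, (F x - F (update x i e)) ^ 2
          ∂((haarProbability (Matrix.specialUnitaryGroup (Fin 2) ℂ)).tilted fun e => V (update x i e))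
          ∂((Measure.pi fun _ : Edge 4 L => haarProbability (Matrix.specialUnitaryGroup (Fin 2) ℂ)).tilted V) := by
    intro F hF hFb
    rw [← hμ]
    exact HeatBathPoincare.su2_heatBathPoincare h0 h hL F hF hFb
  have hA : (0 : ℝ) < (2 - 9 * βW)⁻¹ := inv_pos.2 (by linarith)
  have key := measureReal_deviation_le_le_of_heatBathPoincare (haarProbability (Matrix.specialUnitaryGroup (Fin 2) ℂ)) hVm hVb hP hA hf hM δ hδ hD r
  rw [← hμ] at key
  exact key

/-- ★★ **THE ENERGY, `SU(2)`, `d = 4`, `0 ≤ β_W < 2/9`: CONCENTRATION OF THE WILSON ACTION AT SCALE `|E|^{1/2}`, UNIFORMLY IN THE VOLUME**: on every torus `(ℤ/L)⁴`,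
`L ≥ 2`, with `|E| = 4L⁴` links, `μ{S_W − E_μ S_W ≥ r} ≤ e^{2/3} exp(−r / √(2(2 − 9β_W)⁻¹ · 576 |E|))` (one link moves `S_W` by at most `4(d−1)N = 24`,
`EnergyVariance.abs_wilsonAction_update_sub_le`); i.e. the action density `s = S_W/|Λ_p|` (`|Λ_p| = 6L⁴`) has `μ{s − E s ≥ ρ} ≤ e^{2/3} exp(−0.088 ρ L² (2 − 9β_W)^{1/2})`.
(The cell's pressure-convexity route, ds-3's `TorusEnergyChernoff`, gives volume-order large deviations for `s`; this cell is the generic-observable bound specialised.)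
[folklore] -/
theorem su2_wilsonAction_deviation_ge_le {βW : ℝ} (h0 : 0 ≤ βW) (h : βW < 2 / 9) (hL : 1 < L) (r : ℝ) :
    (wilsonMeasure (d := 4) (L := L) (fundamentalRep (Fin 2)) (βW / 2)).real
        {U | r ≤ wilsonAction (fundamentalRep (Fin 2)) U -
          ∫ U', wilsonAction (fundamentalRep (Fin 2)) U' ∂(wilsonMeasure (d := 4) (L := L) (fundamentalRep (Fin 2)) (βW / 2))} ≤
      Real.exp (2 / 3) * Real.exp (-r / Real.sqrt (2 * (2 - 9 * βW)⁻¹ * (576 * Fintype.card (Edge 4 L)))) := by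
  classical
  have hρc := continuous_fundamentalRep (Fin 2)
  have hfm : Measurable (wilsonAction (d := 4) (L := L) (fundamentalRep (Fin 2))) := measurable_wilsonAction (fundamentalRep (Fin 2)) hρc
  obtain ⟨B₁, hB₁⟩ := exists_abs_wilsonAction_le (d := 4) (L := L) (G := Matrix.specialUnitaryGroup (Fin 2) ℂ) (fundamentalRep (Fin 2)) hρc
  have hδ : ∀ (ℓ : Edge 4 L) (U : GaugeConfig 4 L (Matrix.specialUnitaryGroup (Fin 2) ℂ)) (g : Matrix.specialUnitaryGroup (Fin 2) ℂ),
      |wilsonAction (fundamentalRep (Fin 2)) U - wilsonAction (fundamentalRep (Fin 2)) (update U ℓ g)| ≤ (fun _ : Edge 4 L => (24 : ℝ)) ℓ := by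
    intro ℓ U g
    have h1 := EnergyVariance.abs_wilsonAction_update_sub_le (d := 4) (L := L) (fundamentalRep (Fin 2))
      (fun g => fundamentalRep_mem_unitaryGroup g) ℓ U (U ℓ) g
    rw [update_eq_self] at h1
    norm_num at h1 ⊢
    exact h1
  have hD : 0 < ∑ ℓ : Edge 4 L, (fun _ : Edge 4 L => (24 : ℝ)) ℓ ^ 2 := by
    simp only [Finset.sum_const, Finset.card_univ, nsmul_eq_mul]
    have : (0 : ℝ) < Fintype.card (Edge 4 L) := by exact_mod_cast Fintype.card_pos
    positivity
  have key := su2_measureReal_deviation_ge_le (L := L) h0 h hL (wilsonAction (fundamentalRep (Fin 2))) hfm hB₁ (fun _ => (24 : ℝ)) hδ hD r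
  have e : ∑ ℓ : Edge 4 L, (fun _ : Edge 4 L => (24 : ℝ)) ℓ ^ 2 = 576 * Fintype.card (Edge 4 L) := by
    simp only [Finset.sum_const, Finset.card_univ, nsmul_eq_mul]
    ring
  rw [e] at key
  exact key

end Concentration

end Summit.Ventures.YMGap.RobustBall.HeatBathSweep

end
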